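import Summits.BirchSwinnertonDyer.Rank1Residual.Additive.TwistedBranchPAdicGrossZagierEndState
import Summits.BirchSwinnertonDyer.Rank1Residual.Additive.GordBranchPAdicGrossZagierOdd
import HarnessLib

/-!
# STEP C⁻(3a) (odd branch, `p ≡ 3 (mod 4)`): the rank-one end-state consumers re-keyed to ONE
# admissible `(V, f, ϖ)` (cell `bsd-addord`, seat `bsd-addord-gz` gen 4)

HONEST FRAMING (cell `bsd-addord`; PARTITION (D-0054): EXCLUDED-DOMAIN additive rows §E, B6 = O7-ord r1 ×
every consumer of hFact, rows `p ≡ 3 (mod 4)` — types-the-object-of; booked 0). THEOREMS ONLY. Odd twin of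
`DisegniLineEndStateInputs`: the tree's odd-branch rank-one consumers of the typed input
`BranchPAdicGrossZagierOddAt W p Dh` (`cycLowerBoundAt_of_chiBranchLowerOdd_of_branchPAdicGrossZagierOdd`,
`ClassX3Gord.missingUpperBoundAt_rankOne_of_wuthrichHalf_of_branchPAdicGrossZagierOdd`,
`schneiderConjecture_of_twisted_of_branchCoeffOneNeZero`) re-keyed to the identity at ONE `(V, f, ϖ)`
(minus branch `padicLFunctionMinusBranch`, `ϖ·Ω⁻_V = Ω⁻_f`, `C • V^{(−p)} = W`), which is what STEP C⁻(2)
(`branchPAdicGrossZagier_identity_of_cycLine_odd`) delivers.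

References: [Wuthrich2014] Thm. 16; [Delbourgo2002] Thm. (B); [MazurTateTeitelbaum1986Invent] §I.13–I.14;
[Pal2012] Thm. 3.2; [Miller2011LMS] Def. 1.1.
-/

set_option autoImplicit false

noncomputable section

open scoped Classical MatrixGroups ModularForm NumberField

open CongruenceSubgroup WeierstrassCurve NumberField IsDedekindDomain Field
  Literature.NumberTheory.EllipticCurves Literature.NumberTheory.EllipticCurves.ModularForms
  Literature.NumberTheory.EllipticCurves.Rank1Residual
  Literature.NumberTheory.EllipticCurves.Rank1Residual.Typed
  Literature.NumberTheory.EllipticCurves.Delbourgo2002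
  Literature.NumberTheory.GaloisRepresentations

namespace Summit.BirchSwinnertonDyer.Rank1Residual.Additive

variable {W : WeierstrassCurve ℚ} [W.IsElliptic] [W.IsGloballyMinimal] {p : ℕ} [hp : Fact p.Prime]

omit [W.IsElliptic] [W.IsGloballyMinimal] in
/-- **Schneider for the datum from ONE identity and the analytic certificate, ODD branch** (`p ≡ 3 (mod 4)`):
if `ϖ·[T¹]B⁻·log_p γ = u·q·Reg_p(E,Dh)` at an admissible `(V, f, ϖ)` and `[T¹](ϖ·B⁻) ≠ 0`
(`BranchCoeffOneNeZeroAt W p`), then `Reg_p(E,Dh) ≠ 0`.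
[cite: Delbourgo1998, §2.5 BS-D(p) (i), (ii) (pp. 151–152)] [cite: MazurTateTeitelbaum1986Invent, §I.13–I.14] -/
theorem schneiderConjecture_of_identity_of_branchCoeffOneNeZero_odd (hp4 : p % 4 = 3)
    (hne : BranchCoeffOneNeZeroAt W p) (V : WeierstrassCurve ℚ) [V.IsElliptic] [V.IsGloballyMinimal]
    (C : VariableChange ℚ) (hC : C • V.quadraticTwist ((-1 : ℚ) ^ (p / 2) * p) = W)
    (hord : IsOrdinaryAt V p) {N : ℕ} [NeZero N] (f : CuspForm (Gamma0 N) 2) (hf : IsNewformOf V f)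
    (ϖ : ℚ) (hϖ : (ϖ : ℝ) * V.imaginaryPeriodRat = minusPeriod f) {Dh : PAdicHeightData W p}
    {u : ℤ_[p]ˣ} {q : ℚ}
    (hpgz : (ϖ : ℚ_[p]) *
        PowerSeries.coeff 1 (padicLFunctionMinusBranch f ((unitRoot V p : ℤ_[p]) : ℚ_[p]) (p / 2)) *
        padicLog p (cyclotomicGenerator p) = ((u : ℤ_[p]) : ℚ_[p]) * (q : ℚ_[p]) * padicRegulator Dh) :
    SchneiderConjecture Dh := by
  have hp2 : p ≠ 2 := by omega
  have hodd : ¬ Even (p / 2) := by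
    rw [Nat.not_even_iff_odd]
    exact ⟨p / 4, by omega⟩
  have h1 := hne V C hC hord f hf ϖ (by rw [if_neg hodd]; exact hϖ)
  rw [if_neg hodd, PowerSeries.coeff_C_mul] at h1
  rw [SchneiderConjecture]
  exact padicRegulator_ne_zero_of_twisted_identity hp2 h1 hpgz

variable (W p) in
/-- **RANK ONE, odd branch, the lower factorisation at ONE triple** (copy of
`cycLowerBoundAt_of_chiBranchLowerOdd_of_branchPAdicGrossZagierOdd` with the universal typed input replaced
by the identity at the given `(V, f, ϖ)`): `ChiBranchLowerDivisibilityOddAt W p` and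
`ϖ·[T¹]B⁻·log_p γ = u·q·Reg_p`, `L'(E,1) = q·Ω·R` give `CycLowerBoundAt W p Dh`.
[cite: MazurTateTeitelbaum1986Invent, §I.14] [cite: Delbourgo1998, §2.5 (p. 151) (shape)] -/
theorem cycLowerBoundAt_of_chiBranchLowerOdd_of_identity
    (hmod : hasEntireLFunction_rat) (hGZK : rank_eq_analyticRank_of_analyticRank_le_one)
    (hadd : Addv W p) (hr : W.analyticRank = 1) (hp4 : p % 4 = 3)
    (V : WeierstrassCurve ℚ) [V.IsElliptic] [V.IsGloballyMinimal]
    (hVW : ∃ C : VariableChange ℚ, C • V.quadraticTwist (-(p : ℚ)) = W) (hord : GoodOrd V p)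
    {N : ℕ} [NeZero N] {f : CuspForm (Gamma0 N) 2} (hf : IsNewformOf V f)
    (ϖ : ℚ) (hϖ : (ϖ : ℝ) * V.imaginaryPeriodRat = minusPeriod f)
    {Dh : PAdicHeightData W p} (hdiv : ChiBranchLowerDivisibilityOddAt W p) {u : ℤ_[p]ˣ} {q : ℚ}
    (hlead : W.leadingLCoeff = (q : ℂ) * (W.realPeriodRat : ℂ) * (W.regulator : ℂ))
    (hpgz : (ϖ : ℚ_[p]) *
        PowerSeries.coeff 1 (padicLFunctionMinusBranch f ((unitRoot V p : ℤ_[p]) : ℚ_[p]) (p / 2)) *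
        padicLog p (cyclotomicGenerator p) = ((u : ℤ_[p]) : ℚ_[p]) * (q : ℚ_[p]) * padicRegulator Dh) :
    CycLowerBoundAt W p Dh := by
  -- adapted from `cycLowerBoundAt_of_chiBranchLowerOdd_of_branchPAdicGrossZagierOdd`
  intro κ γ hκ hγ hγ' D fE hchar
  have hmw : W.mordellWeilRank = 1 := by rw [(hGZK W (by rw [hr])).1, hr]
  set B := padicLFunctionMinusBranch f ((unitRoot V p : ℤ_[p]) : ℚ_[p]) (p / 2) with hB_def
  have hmem : fE ∈ D.charIdeal := by rw [hchar]; exact Ideal.mem_span_singleton_self fE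
  obtain ⟨h, hfac⟩ := hdiv V hp4 hVW hord hκ hγ hγ' hf D ϖ hϖ fE hmem
  have hB0 : PowerSeries.constantCoeff B = 0 :=
    constantCoeff_minusBranch_eq_zero_of_analyticRank_eq_one W p hmod hadd hr hp4 V hVW hord hf ϖ hϖ
  have hcoeff : ((PowerSeries.coeff 1 fE : ℤ_[p]) : ℚ_[p]) =
      ((PowerSeries.constantCoeff h : ℤ_[p]) : ℚ_[p]) * (((ϖ : ℚ) : ℚ_[p]) * PowerSeries.coeff 1 B) := by
    have hprod : PowerSeries.coeff 1 (iwasawaToPowerSeries p h * (PowerSeries.C ((ϖ : ℚ) : ℚ_[p]) * B)) =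
        PowerSeries.constantCoeff (iwasawaToPowerSeries p h) *
          PowerSeries.coeff 1 (PowerSeries.C ((ϖ : ℚ) : ℚ_[p]) * B) := by
      rw [PowerSeries.coeff_mul, Finset.Nat.antidiagonal_succ, Finset.sum_cons,
        Finset.Nat.antidiagonal_zero]
      simp [hB0, constantCoeff_iwasawaToPowerSeries]
    rw [← Wuthrich2014.coeff_iwasawaToPowerSeries p fE 1, hfac, hprod,
      constantCoeff_iwasawaToPowerSeries, PowerSeries.coeff_C_mul]
  refine ⟨q, PowerSeries.constantCoeff h * (u : ℤ_[p]), hlead, ?_⟩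
  rw [hmw, pow_one, hcoeff]
  push_cast
  calc ((PowerSeries.constantCoeff h : ℤ_[p]) : ℚ_[p]) * (((ϖ : ℚ) : ℚ_[p]) * PowerSeries.coeff 1 B) *
        padicLog p (cyclotomicGenerator p)
      = ((PowerSeries.constantCoeff h : ℤ_[p]) : ℚ_[p]) *
          ((((ϖ : ℚ) : ℚ_[p]) * PowerSeries.coeff 1 B) * padicLog p (cyclotomicGenerator p)) := by ring
    _ = ((PowerSeries.constantCoeff h : ℤ_[p]) : ℚ_[p]) *
          (((u : ℤ_[p]) : ℚ_[p]) * (q : ℚ_[p]) * padicRegulator Dh) := by rw [hpgz]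
    _ = ((PowerSeries.constantCoeff h : ℤ_[p]) : ℚ_[p]) * ((u : ℤ_[p]) : ℚ_[p]) * (q : ℚ_[p]) *
          padicRegulator Dh := by ring

omit [W.IsGloballyMinimal] in
/-- **X3♯(G-ord) ∩ `I₀*`, `p ≡ 3 (mod 4)`, `r_an = 1`: the UPPER half from ONE identity + the rider +
Wuthrich's half, odd branch** (copy of
`ClassX3Gord.missingUpperBoundAt_rankOne_of_wuthrichHalf_of_branchPAdicGrossZagierOdd` keyed to the given
`(V, C, f, ϖ)`). [cite: Wuthrich2014, Thm. 16 (p. 397)] [cite: Delbourgo2002, Theorem (B) (p. 40)]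
[cite: Miller2011LMS, Def. 1.1] -/
theorem ClassX3Gord.missingUpperBoundAt_rankOne_of_wuthrichHalf_of_identity_odd
    (hWu : Wuthrich2014.thm16_halfEigenCharIdeal_dvd_cyclotomicPrime)
    (hGZK : rank_eq_analyticRank_of_analyticRank_le_one) (hmod : hasEntireLFunction_rat)
    (hX : ClassX3Gord W p) (hp4 : p % 4 = 3) (hr : W.analyticRank = 1)
    {Dh : PAdicHeightData W p} (hB : LeadingTermClauses W p Dh) (hS : SchneiderConjecture Dh)
    (V : WeierstrassCurve ℚ) [V.IsElliptic] [V.IsGloballyMinimal] (hV : GoodOrd V p)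
    (C : VariableChange ℚ) (hC : C • V.quadraticTwist ((-1 : ℚ) ^ (p / 2) * p) = W)
    {N : ℕ} [NeZero N] {f : CuspForm (Gamma0 N) 2} (hf : IsNewformOf V f)
    (ϖ : ℚ) (hϖ : (ϖ : ℝ) * V.imaginaryPeriodRat = minusPeriod f) {u' : ℤ_[p]ˣ} {q : ℚ}
    (hlead : W.leadingLCoeff = (q : ℂ) * (W.realPeriodRat : ℂ) * (W.regulator : ℂ))
    (hpgz : (ϖ : ℚ_[p]) *
        PowerSeries.coeff 1 (padicLFunctionMinusBranch f ((unitRoot V p : ℤ_[p]) : ℚ_[p]) (p / 2)) *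
        padicLog p (cyclotomicGenerator p) = ((u' : ℤ_[p]) : ℚ_[p]) * (q : ℚ_[p]) * padicRegulator Dh) :
    MissingUpperBoundAt W p := by
  -- adapted from `ClassX3Gord.missingUpperBoundAt_rankOne_of_wuthrichHalf_of_branchPAdicGrossZagierOdd`
  have hp2 : p ≠ 2 := by omega
  have hodd : ¬ Even (p / 2) := by
    rw [Nat.not_even_iff_odd]
    exact ⟨p / 4, by omega⟩
  have hmw : W.mordellWeilRank = 1 := by rw [(hGZK W (by rw [hr])).1, hr]
  obtain ⟨κ, γ, hκ, hγ, hγ', D, fE, hchar⟩ := exists_cyclotomic_dualData_generator W p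
  haveI : Module.Finite (IwasawaAlgebra p) D.X :=
    SelmerDualData.module_finite_of_isCyclotomic (W := W) (κ := κ) hκ D hγ
  have hj := padicValRat_j_nonneg_of_typeGOrd W p hX.typeGOrd
  have hϖ' : (if Even (p / 2) then (ϖ : ℝ) * V.realPeriodRat = plusPeriod f
      else (ϖ : ℝ) * V.imaginaryPeriodRat = minusPeriod f) := by
    rw [if_neg hodd]; exact hϖ
  obtain ⟨hXt, g, hg, u, hι⟩ := isTorsion_and_exists_iota_eq_branch_of_wuthrichComponent W p
    (Wuthrich2014.charIdeal_dvd_padicLFunctionBranch_component_of_half hWu) hj hp2 V ⟨C, hC⟩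
    (Or.inl hV) hX.classX3.1 hκ hγ hγ' hf D ϖ hϖ'
  rw [if_neg hodd] at hι
  have hpgz' : ((ϖ : ℚ) : ℚ_[p]) * PowerSeries.coeff W.mordellWeilRank
        (padicLFunctionMinusBranch f ((unitRoot V p : ℤ_[p]) : ℚ_[p]) (p / 2)) *
        padicLog p (cyclotomicGenerator p) ^ W.mordellWeilRank =
      ((u' : ℤ_[p]) : ℚ_[p]) * (q : ℚ_[p]) * padicRegulator Dh := by
    rw [hmw, pow_one]
    exact hpgz
  exact missingUpperBoundAt_rankOne_of_iota_eq_of_pgz hp2 hGZK hmod hr hB hS hκ hγ hγ' D hXt hchar hg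
    hι hlead hpgz'

end Summit.BirchSwinnertonDyer.Rank1Residual.Additive

end
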